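import Summits.AtomisticToContinuum.Crystallization.Theorems.FrustratedLawDichotomyStrainedPatchHomLeafTableClassHcpV

/-!
# hcp vector-form leaf checker — REAL READING of the moments `GG, gg, CC` and of the penalty `penV`

decomp-a2c hand-2 g25 (crux `AperiodicFrustratedLawGap`, stmt-AtomisticToContinuum-27623; (H) hcp P-twin, critic rows 887/891/893).  The bridge,
part 3: for a passing fold with treated set `S` and weights `D̂_l/SC`, the checker's integers read `GGof(…)_cc' = SC³·2Γ_cc'`, `ggof(…)_c = SC²·2γ_c`,
`C2 = SC·2C` with the real moments `Γ = Σ_S D̂/SC · z⁰z⁰ᵀ`, `γ = Σ_S D̂/SC · u z⁰`, `C = Σ_S D̂/SC · u` of `…HomLeafMomentsHcpV`; the penalty numerator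
`penV` reads as the six kernel terms `KT1 … KT6` in reals, and ★ `pen_bound`: `SC⁵ ·` (the bracket of `functional_lower_bound` at `V̂ = v/SC`,
`Ŵ = w/SC`, `Ŵη = m/SC`) `≤ penV`, hence `≤ SC³·GV`.  0 sorry; standard axioms.  `--supports stmt-AtomisticToContinuum-27623`.
-/

noncomputable section

namespace Summit.AtomisticToContinuum.Crystallization.Theorems.FrustratedLawDichotomyStrainedPatchHomLeafTableCheckHcpV

open scoped BigOperators
open Finset
open Literature.Analysis.ValidatedNumerics.Numerics
open Summit.AtomisticToContinuum.Crystallization.Theorems.FrustratedLawDichotomyStrainedPatchHomLeafTableCheck (Row QT sgnZ SCN SCN_eq)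
open Summit.AtomisticToContinuum.Crystallization.Theorems.FrustratedLawDichotomyStrainedPatchHomLeafTableCheckHcp (NH famZ NH.ok_iff)

/-! ## §1. The moments of a passing fold: integer closed forms and real readings -/

/-- The signed derivative reading `D̂` (scale `SC`) of a record's row. -/
def Dz (tab : QT) (k : LV) (l : NH) : ℤ := sgnZ (rowTV tab k l).sD (rowTV tab k l).aD

open Classical in
/-- The treated records as a finset. -/
def trS (tab : QT) (k : LV) (labs : List NH) : Finset NH := (labs.filter (fun l => treatedV tab k l)).toFinset

/-- Real moment `Γ_cc' = Σ_S (D̂/SC) (Z_c/SC) (Z_c'/SC)`. -/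
def GamR (tab : QT) (k : LV) (labs : List NH) (c c' : Fin 3) : ℝ :=
  ∑ l ∈ trS tab k labs, ((Dz tab k l : ℤ) : ℝ) / SC * ((((ZZ k l c : ℤ) : ℝ) / SC) * (((ZZ k l c' : ℤ) : ℝ) / SC))

/-- Real moment `γ_c = Σ_S (D̂/SC) u (Z_c/SC)`. -/
def gamR (tab : QT) (k : LV) (labs : List NH) (c : Fin 3) : ℝ :=
  ∑ l ∈ trS tab k labs, ((Dz tab k l : ℤ) : ℝ) / SC * ((l.u : ℝ) * (((ZZ k l c : ℤ) : ℝ) / SC))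

/-- Real moment `C = Σ_S (D̂/SC) u`. -/
def CR (tab : QT) (k : LV) (labs : List NH) : ℝ := ∑ l ∈ trS tab k labs, ((Dz tab k l : ℤ) : ℝ) / SC * (l.u : ℝ)

open Classical in
/-- Members of the treated finset are consistent records (given the list is). [formal bookkeeping] -/
theorem ok_of_mem_trS {tab : QT} {k : LV} {labs : List NH} (hok : ∀ l ∈ labs, l.ok = true) {l : NH} (hl : l ∈ trS tab k labs) : l.ok = true :=
  hok l (List.filter_sublist.subset (List.mem_toFinset.1 hl))

/-- `Z_c = SC·e_c + u·η̂_c` in `ℤ`. [formal bookkeeping] -/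
theorem ZZ_int (k : LV) (l : NH) (c : Fin 3) : ZZ k l c = (SCN : ℤ) * eZ l c + (l.u : ℤ) * k.nZ c := by
  fin_cases c <;>
  · simp only [ZZ, Z0, Z1, Z2, eZ, LV.nZ, Int.add_def, Int.mul_def, Fin.zero_eta, Fin.isValue, Fin.mk_one, Fin.reduceFinMk,
      Matrix.cons_val_zero, Matrix.cons_val_one, Matrix.cons_val]

/-- `u² = u` in `ℤ` for a consistent record. [formal bookkeeping] -/
theorem u_sq_int {l : NH} (hl : l.ok = true) : (l.u : ℤ) * (l.u : ℤ) = (l.u : ℤ) := by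
  obtain ⟨-, hu, hφ⟩ := record_facts hl
  rw [hu, hφ]

/-- `2 Z_c Z_c' = SC²·(2e_ce_c') + SC·(η̂_c'·2ue_c + η̂_c·2ue_c') + η̂_cη̂_c'·2u`. [formal bookkeeping] -/
theorem two_ZZ_mul (k : LV) {l : NH} (hl : l.ok = true) (c c' : Fin 3) :
    2 * (ZZ k l c * ZZ k l c') = (SCN : ℤ) * (SCN : ℤ) * (2 * (eZ l c * eZ l c')) +
      (SCN : ℤ) * (k.nZ c' * (2 * ((l.u : ℤ) * eZ l c)) + k.nZ c * (2 * ((l.u : ℤ) * eZ l c'))) + k.nZ c * k.nZ c' * (2 * (l.u : ℤ)) := by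
  rw [ZZ_int, ZZ_int]
  linear_combination (2 * k.nZ c * k.nZ c') * u_sq_int hl

/-- `2u Z_c = SC·(2ue_c) + η̂_c·2u`. [formal bookkeeping] -/
theorem two_u_ZZ (k : LV) {l : NH} (hl : l.ok = true) (c : Fin 3) :
    2 * ((l.u : ℤ) * ZZ k l c) = (SCN : ℤ) * (2 * ((l.u : ℤ) * eZ l c)) + k.nZ c * (2 * (l.u : ℤ)) := by
  rw [ZZ_int]
  linear_combination (2 * k.nZ c) * u_sq_int hl

open Classical in
/-- ★ `GGof(2A_cc', 2B_c, 2B_c', η̂_c, η̂_c', 2C) = Σ_S D̂ · 2 Z_c Z_c'` in `ℤ`. [formal bookkeeping] -/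
theorem GG_int {tab : QT} {k : LV} {labs : List NH} (hokA : (foldV tab k accV0 labs).ok = true) (hok : ∀ l ∈ labs, l.ok = true)
    (hnd : labs.Nodup) (c c' : Fin 3) :
    GGof (A2Z (foldV tab k accV0 labs) c c') (B2Z (foldV tab k accV0 labs) c) (B2Z (foldV tab k accV0 labs) c') (k.nZ c) (k.nZ c')
        (C2 (foldV tab k accV0 labs)) = ∑ l ∈ trS tab k labs, Dz tab k l * (2 * (ZZ k l c * ZZ k l c')) := by
  unfold GGof
  simp only [Int.add_def, Int.mul_def]
  rw [A2Z_eq_sum hokA hok hnd, B2Z_eq_sum hokA hok hnd, B2Z_eq_sum hokA hok hnd, C2_eq_sum hokA hok hnd]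
  unfold trS Dz
  simp only [Finset.mul_sum, ← Finset.sum_add_distrib]
  refine Finset.sum_congr rfl fun l hl => ?_
  rw [two_ZZ_mul k (hok l (List.filter_sublist.subset (List.mem_toFinset.1 hl))) c c']
  ring

open Classical in
/-- ★ `ggof(2B_c, η̂_c, 2C) = Σ_S D̂ · 2u Z_c` in `ℤ`. [formal bookkeeping] -/
theorem gg_int {tab : QT} {k : LV} {labs : List NH} (hokA : (foldV tab k accV0 labs).ok = true) (hok : ∀ l ∈ labs, l.ok = true)
    (hnd : labs.Nodup) (c : Fin 3) :
    ggof (B2Z (foldV tab k accV0 labs) c) (k.nZ c) (C2 (foldV tab k accV0 labs)) = ∑ l ∈ trS tab k labs, Dz tab k l * (2 * ((l.u : ℤ) * ZZ k l c)) := by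
  unfold ggof
  simp only [Int.add_def, Int.mul_def]
  rw [B2Z_eq_sum hokA hok hnd, C2_eq_sum hokA hok hnd]
  unfold trS Dz
  simp only [Finset.mul_sum, ← Finset.sum_add_distrib]
  refine Finset.sum_congr rfl fun l hl => ?_
  rw [two_u_ZZ k (hok l (List.filter_sublist.subset (List.mem_toFinset.1 hl))) c]
  ring

open Classical in
/-- ★ `GGof(…) = SC³ · 2Γ_cc'` in reals. [formal bookkeeping] -/
theorem GG_real {tab : QT} {k : LV} {labs : List NH} (hokA : (foldV tab k accV0 labs).ok = true) (hok : ∀ l ∈ labs, l.ok = true)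
    (hnd : labs.Nodup) (c c' : Fin 3) :
    ((GGof (A2Z (foldV tab k accV0 labs) c c') (B2Z (foldV tab k accV0 labs) c) (B2Z (foldV tab k accV0 labs) c') (k.nZ c) (k.nZ c')
        (C2 (foldV tab k accV0 labs)) : ℤ) : ℝ) = (SC : ℝ) ^ 3 * (2 * GamR tab k labs c c') := by
  have hS := SC_pos
  rw [GG_int hokA hok hnd]
  unfold GamR
  push_cast
  rw [Finset.mul_sum, Finset.mul_sum]
  refine Finset.sum_congr rfl fun l _ => ?_
  field_simp

open Classical in
/-- ★ `ggof(…) = SC² · 2γ_c` in reals. [formal bookkeeping] -/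
theorem gg_real {tab : QT} {k : LV} {labs : List NH} (hokA : (foldV tab k accV0 labs).ok = true) (hok : ∀ l ∈ labs, l.ok = true)
    (hnd : labs.Nodup) (c : Fin 3) :
    ((ggof (B2Z (foldV tab k accV0 labs) c) (k.nZ c) (C2 (foldV tab k accV0 labs)) : ℤ) : ℝ) = (SC : ℝ) ^ 2 * (2 * gamR tab k labs c) := by
  have hS := SC_pos
  rw [gg_int hokA hok hnd]
  unfold gamR
  push_cast
  rw [Finset.mul_sum, Finset.mul_sum]
  refine Finset.sum_congr rfl fun l _ => ?_
  field_simp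

open Classical in
/-- ★ `2C (checker) = SC · 2C (real)`. [formal bookkeeping] -/
theorem C2_real {tab : QT} {k : LV} {labs : List NH} (hokA : (foldV tab k accV0 labs).ok = true) (hok : ∀ l ∈ labs, l.ok = true)
    (hnd : labs.Nodup) : ((C2 (foldV tab k accV0 labs) : ℤ) : ℝ) = (SC : ℝ) * (2 * CR tab k labs) := by
  have hS := SC_pos
  rw [C2_eq_sum hokA hok hnd]
  unfold CR trS Dz
  push_cast
  rw [Finset.mul_sum, Finset.mul_sum]
  refine Finset.sum_congr rfl fun l _ => ?_
  field_simp

/-! ## §2. The penalty numerator in reals -/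

/-- The symmetric integer table from six data. -/
def sym3 (G00 G11 G22 G01 G02 G12 : ℤ) : Fin 3 → Fin 3 → ℤ := ![![G00, G01, G02], ![G01, G11, G12], ![G02, G12, G22]]

/-- The six kernel terms of `penV`, read in reals (integers cast; `|·|` for `natAbs`). -/
def KT (k : LV) (GZ : Fin 3 → Fin 3 → ℤ) (gZ : Fin 3 → ℤ) (CC : ℤ) : ℝ :=
  (∑ a, ∑ c, |∑ c', ((k.vZ a c' : ℤ) : ℝ) * ((GZ c c' : ℤ) : ℝ)| * ((k.wN a c : ℕ) : ℝ))
  + (∑ c, |∑ c'', (∑ a, ((k.vZ a c : ℤ) : ℝ) * ((k.vZ a c'' : ℤ) : ℝ)) * ((gZ c'' : ℤ) : ℝ)| * ((k.mN c : ℕ) : ℝ))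
  + (∑ a, |∑ c, ((k.vZ a c : ℤ) : ℝ) * ((gZ c : ℤ) : ℝ)| * ∑ c, ((k.wN a c : ℕ) : ℝ) * ((k.mN c : ℕ) : ℝ))
  + (∑ a, ∑ c, ((k.wN a c : ℕ) : ℝ) * ∑ c', ((k.wN a c' : ℕ) : ℝ) * |((GZ c c' : ℤ) : ℝ)|)
  + (∑ a, (∑ c, ((k.wN a c : ℕ) : ℝ) * |((gZ c : ℤ) : ℝ)|) * ∑ c, (|((k.vZ a c : ℤ) : ℝ)| + ((k.wN a c : ℕ) : ℝ)) * ((k.mN c : ℕ) : ℝ))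
  + |((CC : ℤ) : ℝ)| * ∑ a, (∑ c, (|((k.vZ a c : ℤ) : ℝ)| + ((k.wN a c : ℕ) : ℝ)) * ((k.mN c : ℕ) : ℝ)) *
      (∑ c, (|((k.vZ a c : ℤ) : ℝ)| + ((k.wN a c : ℕ) : ℝ)) * ((k.mN c : ℕ) : ℝ))

set_option maxHeartbeats 800000 in
/-- ★ The penalty numerator `penV` equals the six kernel terms read in reals. [formal bookkeeping] -/
theorem penV_real (k : LV) (G00 G11 G22 G01 G02 G12 g0 g1 g2 CC : ℤ) :
    ((penV k G00 G11 G22 G01 G02 G12 g0 g1 g2 CC : ℕ) : ℝ) = KT k (sym3 G00 G11 G22 G01 G02 G12) ![g0, g1, g2] CC := by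
  have h : ∀ x : ℤ, ((x.natAbs : ℕ) : ℝ) = |((x : ℤ) : ℝ)| := fun x => by rw [Nat.cast_natAbs, Int.cast_abs]
  simp only [penV, adot, KT, sym3, LV.vZ, LV.wN, LV.mN, Nat.add_eq, Nat.mul_eq, Int.add_def, Int.mul_def, Fin.sum_univ_three, Fin.isValue,
    Matrix.cons_val_zero, Matrix.cons_val_one, Matrix.cons_val]
  push_cast
  simp only [h]
  push_cast
  ring

/-- The bracket of `functional_lower_bound` at `V̂ = v/SC`, `Ŵ = w/SC`, `Ŵη = m/SC`. -/
def PENR (k : LV) (Γ : Fin 3 → Fin 3 → ℝ) (γ : Fin 3 → ℝ) (C : ℝ) : ℝ :=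
  2 * ∑ a, ∑ c, ((k.wN a c : ℕ) : ℝ) / SC * |∑ c', ((k.vZ a c' : ℤ) : ℝ) / SC * Γ c' c|
    + 2 * ∑ c, ((k.mN c : ℕ) : ℝ) / SC * |∑ a, ((k.vZ a c : ℤ) : ℝ) / SC * ∑ c', ((k.vZ a c' : ℤ) : ℝ) / SC * γ c'|
    + 2 * ∑ a, |∑ c, ((k.vZ a c : ℤ) : ℝ) / SC * γ c| * ∑ c, ((k.wN a c : ℕ) : ℝ) / SC * (((k.mN c : ℕ) : ℝ) / SC)
    + ∑ a, ∑ c, ∑ c', ((k.wN a c : ℕ) : ℝ) / SC * (((k.wN a c' : ℕ) : ℝ) / SC) * |Γ c c'|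
    + 2 * ∑ a, (∑ c, ((k.wN a c : ℕ) : ℝ) / SC * |γ c|) * ∑ c, (|((k.vZ a c : ℤ) : ℝ) / SC| + ((k.wN a c : ℕ) : ℝ) / SC) * (((k.mN c : ℕ) : ℝ) / SC)
    + |C| * ∑ a, (∑ c, (|((k.vZ a c : ℤ) : ℝ) / SC| + ((k.wN a c : ℕ) : ℝ) / SC) * (((k.mN c : ℕ) : ℝ) / SC)) ^ 2

set_option maxHeartbeats 800000 in
/-- ★ **THE PENALTY BOUND**: `SC⁵ · PENR ≤ KT` when `GZ_cc' = SC³·2Γ_cc'` (with `Γ` symmetric), `gZ_c = SC²·2γ_c`, `CC = SC·2C`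
(terms 1, 2, 3, 5 with equality, terms 4 and 6 with a factor `2` to spare). [formal bookkeeping] -/
theorem pen_bound (k : LV) (GZ : Fin 3 → Fin 3 → ℤ) (gZ : Fin 3 → ℤ) (CC : ℤ) (Γ : Fin 3 → Fin 3 → ℝ) (γ : Fin 3 → ℝ) (C : ℝ)
    (hG : ∀ c c', ((GZ c c' : ℤ) : ℝ) = (SC : ℝ) ^ 3 * (2 * Γ c c')) (hsym : ∀ c c', Γ c c' = Γ c' c)
    (hg : ∀ c, ((gZ c : ℤ) : ℝ) = (SC : ℝ) ^ 2 * (2 * γ c)) (hC : ((CC : ℤ) : ℝ) = (SC : ℝ) * (2 * C)) :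
    (SC : ℝ) ^ 5 * PENR k Γ γ C ≤ KT k GZ gZ CC := by
  have hS := SC_pos
  have hS2 : (0 : ℝ) < SC ^ 2 := pow_pos hS 2
  have hS3 : (0 : ℝ) < SC ^ 3 := pow_pos hS 3
  have hS4 : (0 : ℝ) < SC ^ 4 := pow_pos hS 4
  unfold PENR KT
  set v : Fin 3 → Fin 3 → ℝ := fun a c => ((k.vZ a c : ℤ) : ℝ) with hv
  set w : Fin 3 → Fin 3 → ℝ := fun a c => ((k.wN a c : ℕ) : ℝ) with hw
  set m : Fin 3 → ℝ := fun c => ((k.mN c : ℕ) : ℝ) with hm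
  have hw0 : ∀ a c, 0 ≤ w a c := fun a c => Nat.cast_nonneg _
  have hm0 : ∀ c, 0 ≤ m c := fun c => Nat.cast_nonneg _
  -- term 1
  have t1 : ∀ a c, (SC : ℝ) ^ 5 * (2 * (w a c / SC * |∑ c', v a c' / SC * Γ c' c|)) = |∑ c', v a c' * ((GZ c c' : ℤ) : ℝ)| * w a c := by
    intro a c
    set X := ∑ c', v a c' / SC * Γ c' c with hX
    have e : ∑ c', v a c' * ((GZ c c' : ℤ) : ℝ) = (2 * SC ^ 4) * X := by
      rw [hX, Finset.mul_sum]; refine Finset.sum_congr rfl fun c' _ => ?_; rw [hG c c', hsym c c']; field_simp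
    rw [e, abs_mul, abs_of_pos (by nlinarith [hS4] : (0 : ℝ) < 2 * SC ^ 4)]; field_simp
  -- term 2
  have t2 : ∀ c, (SC : ℝ) ^ 5 * (2 * (m c / SC * |∑ a, v a c / SC * ∑ c', v a c' / SC * γ c'|)) =
      |∑ c'', (∑ a, v a c * v a c'') * ((gZ c'' : ℤ) : ℝ)| * m c := by
    intro c
    set X := ∑ a, v a c / SC * ∑ c', v a c' / SC * γ c' with hX
    have e : ∑ c'', (∑ a, v a c * v a c'') * ((gZ c'' : ℤ) : ℝ) = (2 * SC ^ 4) * X := by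
      rw [hX]; simp only [Fin.sum_univ_three, hg]; field_simp; ring
    rw [e, abs_mul, abs_of_pos (by nlinarith [hS4] : (0 : ℝ) < 2 * SC ^ 4)]; field_simp
  -- term 3
  have t3 : ∀ a, (SC : ℝ) ^ 5 * (2 * (|∑ c, v a c / SC * γ c| * ∑ c, w a c / SC * (m c / SC))) =
      |∑ c, v a c * ((gZ c : ℤ) : ℝ)| * ∑ c, w a c * m c := by
    intro a
    set X := ∑ c, v a c / SC * γ c with hX
    set X2 := ∑ c, w a c * m c with hX2
    have e : ∑ c, v a c * ((gZ c : ℤ) : ℝ) = (2 * SC ^ 3) * X := by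
      rw [hX, Finset.mul_sum]; refine Finset.sum_congr rfl fun c _ => ?_; rw [hg c]; field_simp
    have e2 : ∑ c, w a c / SC * (m c / SC) = X2 / SC ^ 2 := by
      rw [hX2, Finset.sum_div]; refine Finset.sum_congr rfl fun c _ => ?_; field_simp
    rw [e, e2, abs_mul, abs_of_pos (by nlinarith [hS3] : (0 : ℝ) < 2 * SC ^ 3)]; field_simp
  -- term 4 (factor 2 to spare)
  have t4 : ∀ a c c', (SC : ℝ) ^ 5 * (w a c / SC * (w a c' / SC) * |Γ c c'|) ≤ w a c * (w a c' * |((GZ c c' : ℤ) : ℝ)|) := by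
    intro a c c'
    rw [hG c c', abs_mul, abs_mul, abs_of_pos hS3, abs_two]
    have h0 : 0 ≤ w a c * w a c' * |Γ c c'| := mul_nonneg (mul_nonneg (hw0 a c) (hw0 a c')) (abs_nonneg _)
    have e : (SC : ℝ) ^ 5 * (w a c / SC * (w a c' / SC) * |Γ c c'|) = SC ^ 3 * (w a c * w a c' * |Γ c c'|) := by field_simp
    rw [e]
    have h' : 0 ≤ (SC : ℝ) ^ 3 * (w a c * w a c' * |Γ c c'|) := mul_nonneg hS3.le h0
    linarith [h']
  -- term 5
  have t5 : ∀ a, (SC : ℝ) ^ 5 * (2 * ((∑ c, w a c / SC * |γ c|) * ∑ c, (|v a c / SC| + w a c / SC) * (m c / SC))) =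
      (∑ c, w a c * |((gZ c : ℤ) : ℝ)|) * ∑ c, (|v a c| + w a c) * m c := by
    intro a
    set X1 := ∑ c, w a c * |γ c| with hX1
    set X2 := ∑ c, (|v a c| + w a c) * m c with hX2
    have e1 : ∑ c, w a c * |((gZ c : ℤ) : ℝ)| = (2 * SC ^ 2) * X1 := by
      rw [hX1, Finset.mul_sum]; refine Finset.sum_congr rfl fun c _ => ?_
      rw [hg c, abs_mul, abs_mul, abs_of_pos hS2, abs_two]; ring
    have e2 : ∑ c, (|v a c / SC| + w a c / SC) * (m c / SC) = X2 / SC ^ 2 := by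
      rw [hX2, Finset.sum_div]; refine Finset.sum_congr rfl fun c _ => ?_; rw [abs_div, abs_of_pos hS]; field_simp
    have e3 : ∑ c, w a c / SC * |γ c| = X1 / SC := by
      rw [hX1, Finset.sum_div]; refine Finset.sum_congr rfl fun c _ => ?_; field_simp
    rw [e1, e2, e3]; field_simp
  -- term 6 (factor 2 to spare)
  have t6 : (SC : ℝ) ^ 5 * (|C| * ∑ a, (∑ c, (|v a c / SC| + w a c / SC) * (m c / SC)) ^ 2) ≤
      |((CC : ℤ) : ℝ)| * ∑ a, (∑ c, (|v a c| + w a c) * m c) * (∑ c, (|v a c| + w a c) * m c) := by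
    set Y : Fin 3 → ℝ := fun a => ∑ c, (|v a c| + w a c) * m c with hY
    have e2 : ∀ a, ∑ c, (|v a c / SC| + w a c / SC) * (m c / SC) = Y a / SC ^ 2 := by
      intro a; rw [hY, Finset.sum_div]; refine Finset.sum_congr rfl fun c _ => ?_; rw [abs_div, abs_of_pos hS]; field_simp
    simp only [e2]
    have hYa : ∀ a, (∑ c, (|v a c| + w a c) * m c) = Y a := fun a => rfl
    simp only [hYa]
    rw [hC, abs_mul, abs_mul, abs_of_pos hS, abs_two]
    have hY0 : 0 ≤ ∑ a, Y a * Y a := Finset.sum_nonneg fun a _ => mul_self_nonneg _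
    have e4 : ∑ a, (Y a / SC ^ 2) ^ 2 = (∑ a, Y a * Y a) / SC ^ 4 := by
      rw [Finset.sum_div]; refine Finset.sum_congr rfl fun a _ => ?_; field_simp
    rw [e4]
    have e5 : (SC : ℝ) ^ 5 * (|C| * ((∑ a, Y a * Y a) / SC ^ 4)) = SC * (|C| * ∑ a, Y a * Y a) := by field_simp
    rw [e5]
    have h3 : 0 ≤ (SC : ℝ) * |C| * ∑ a, Y a * Y a := mul_nonneg (mul_nonneg hS.le (abs_nonneg C)) hY0
    linarith [h3]
  -- assemble
  have s1 : (SC : ℝ) ^ 5 * (2 * ∑ a, ∑ c, w a c / SC * |∑ c', v a c' / SC * Γ c' c|) = ∑ a, ∑ c, |∑ c', v a c' * ((GZ c c' : ℤ) : ℝ)| * w a c := by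
    rw [Finset.mul_sum, Finset.mul_sum]; refine Finset.sum_congr rfl fun a _ => ?_
    rw [Finset.mul_sum, Finset.mul_sum]; exact Finset.sum_congr rfl fun c _ => t1 a c
  have s2 : (SC : ℝ) ^ 5 * (2 * ∑ c, m c / SC * |∑ a, v a c / SC * ∑ c', v a c' / SC * γ c'|) =
      ∑ c, |∑ c'', (∑ a, v a c * v a c'') * ((gZ c'' : ℤ) : ℝ)| * m c := by
    rw [Finset.mul_sum, Finset.mul_sum]; exact Finset.sum_congr rfl fun c _ => t2 c
  have s3 : (SC : ℝ) ^ 5 * (2 * ∑ a, |∑ c, v a c / SC * γ c| * ∑ c, w a c / SC * (m c / SC)) =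
      ∑ a, |∑ c, v a c * ((gZ c : ℤ) : ℝ)| * ∑ c, w a c * m c := by
    rw [Finset.mul_sum, Finset.mul_sum]; exact Finset.sum_congr rfl fun a _ => t3 a
  have s4 : (SC : ℝ) ^ 5 * ∑ a, ∑ c, ∑ c', w a c / SC * (w a c' / SC) * |Γ c c'| ≤ ∑ a, ∑ c, w a c * ∑ c', w a c' * |((GZ c c' : ℤ) : ℝ)| := by
    rw [Finset.mul_sum]; refine Finset.sum_le_sum fun a _ => ?_
    rw [Finset.mul_sum]; refine Finset.sum_le_sum fun c _ => ?_
    rw [Finset.mul_sum, Finset.mul_sum]; exact Finset.sum_le_sum fun c' _ => t4 a c c'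
  have s5 : (SC : ℝ) ^ 5 * (2 * ∑ a, (∑ c, w a c / SC * |γ c|) * ∑ c, (|v a c / SC| + w a c / SC) * (m c / SC)) =
      ∑ a, (∑ c, w a c * |((gZ c : ℤ) : ℝ)|) * ∑ c, (|v a c| + w a c) * m c := by
    rw [Finset.mul_sum, Finset.mul_sum]; exact Finset.sum_congr rfl fun a _ => t5 a
  have expand : (SC : ℝ) ^ 5 * (2 * ∑ a, ∑ c, w a c / SC * |∑ c', v a c' / SC * Γ c' c|
      + 2 * ∑ c, m c / SC * |∑ a, v a c / SC * ∑ c', v a c' / SC * γ c'|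
      + 2 * ∑ a, |∑ c, v a c / SC * γ c| * ∑ c, w a c / SC * (m c / SC)
      + ∑ a, ∑ c, ∑ c', w a c / SC * (w a c' / SC) * |Γ c c'|
      + 2 * ∑ a, (∑ c, w a c / SC * |γ c|) * ∑ c, (|v a c / SC| + w a c / SC) * (m c / SC)
      + |C| * ∑ a, (∑ c, (|v a c / SC| + w a c / SC) * (m c / SC)) ^ 2) =
    (SC : ℝ) ^ 5 * (2 * ∑ a, ∑ c, w a c / SC * |∑ c', v a c' / SC * Γ c' c|)
      + (SC : ℝ) ^ 5 * (2 * ∑ c, m c / SC * |∑ a, v a c / SC * ∑ c', v a c' / SC * γ c'|)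
      + (SC : ℝ) ^ 5 * (2 * ∑ a, |∑ c, v a c / SC * γ c| * ∑ c, w a c / SC * (m c / SC))
      + (SC : ℝ) ^ 5 * ∑ a, ∑ c, ∑ c', w a c / SC * (w a c' / SC) * |Γ c c'|
      + (SC : ℝ) ^ 5 * (2 * ∑ a, (∑ c, w a c / SC * |γ c|) * ∑ c, (|v a c / SC| + w a c / SC) * (m c / SC))
      + (SC : ℝ) ^ 5 * (|C| * ∑ a, (∑ c, (|v a c / SC| + w a c / SC) * (m c / SC)) ^ 2) := by ring
  rw [expand, s1, s2, s3, s5]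
  linarith [s4, t6]

end Summit.AtomisticToContinuum.Crystallization.Theorems.FrustratedLawDichotomyStrainedPatchHomLeafTableCheckHcpV

end
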